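import Mathlib.Analysis.SpecialFunctions.Pow.Asymptotics
import Mathlib.Analysis.SpecialFunctions.Sqrt

/-!
# Route EIHFluxBalance — `ModulatedKerrHandoff`, stub `stub_oneHoleMatching`: the weight and the rates

Helper file for the crux `stmt-FinalStateConjecture-10167`
(`Summit.FinalStateConjecture.FinalStateConjecture.Theses.EIHFluxBalance.ModulatedKerrHandoff`),
line `photon-rocket-modulation`, stub `stub_oneHoleMatching` (one-hole profile matching).

Elementary real analysis of the last step of the matching: the cone weight `1 + √(√(d⁷)) = 1 + d^{7/4}`
of the stub against the scale `ε = (max 1 d)⁻¹` carried by the tame bound is at most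
`2 + √(√((2t)³)) = 2 + (2t)^{3/4}` on the cone (`d ≤ 2t`; `weight_mul_scale_le`), and the resulting
majorant `(2 + (2t)^{3/4})(1/t + 1/(ct)^{3/4+σ})` tends to `0` (`tendsto_weight_mul_rate`): the
monopole rate `σ > 0` is exactly what beats the weight (`t^{3/4} · t^{-(3/4+σ)} = t^{-σ}`), as recorded
in the line's kit toy j005293. [folklore]
-/

noncomputable section

-- `Summit.<S>.<S>.…` (single-problem summit, D-0017) trips core's duplicate-namespace linter.
set_option linter.dupNamespace false

open Filter Topology Real

namespace Summit.FinalStateConjecture.FinalStateConjecture.Theorems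

namespace OneHole

/-- `√(√y) = y^{1/4}` for `y ≥ 0`. [folklore] -/
theorem sqrt_sqrt_eq_rpow {y : ℝ} (hy : 0 ≤ y) : √(√y) = y ^ (1 / 4 : ℝ) := by
  rw [Real.sqrt_eq_rpow, Real.sqrt_eq_rpow, ← Real.rpow_mul hy]
  norm_num

/-- `√(√((2t)³)) = (2t)^{3/4}` for `t ≥ 0`. [folklore] -/
theorem sqrt_sqrt_cube (t : ℝ) (ht : 0 ≤ t) : √(√((2 * t) ^ 3)) = (2 * t) ^ (3 / 4 : ℝ) := by
  rw [sqrt_sqrt_eq_rpow (by positivity), ← Real.rpow_natCast, ← Real.rpow_mul (by positivity)]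
  norm_num

/-- **The cone weight against the scale**: for `0 ≤ d ≤ 2t`,
`(1 + √(√(d⁷))) (max 1 d)⁻¹ ≤ 2 + √(√((2t)³))`. [folklore] -/
theorem weight_mul_scale_le {d t : ℝ} (hd0 : 0 ≤ d) (hd : d ≤ 2 * t) :
    (1 + √(√(d ^ 7))) * (max 1 d)⁻¹ ≤ 2 + √(√((2 * t) ^ 3)) := by
  have hw0 : 0 ≤ √(√((2 * t) ^ 3)) := Real.sqrt_nonneg _
  rcases le_or_gt d 1 with hd1 | hd1
  · rw [max_eq_left hd1, inv_one, mul_one]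
    have h : √(√(d ^ 7)) ≤ 1 := by
      rw [Real.sqrt_le_one, Real.sqrt_le_one]
      exact pow_le_one₀ hd0 hd1
    linarith
  · have hd0' : 0 < d := by linarith
    rw [max_eq_right hd1.le, add_mul, one_mul]
    have h1 : d⁻¹ ≤ 1 := inv_le_one_of_one_le₀ hd1.le
    have h2 : √(√(d ^ 7)) * d⁻¹ = √(√(d ^ 3)) := by
      rw [sqrt_sqrt_eq_rpow (by positivity), sqrt_sqrt_eq_rpow (by positivity),
        ← Real.rpow_natCast d 7, ← Real.rpow_natCast d 3, ← Real.rpow_mul hd0, ← Real.rpow_mul hd0,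
        ← Real.rpow_neg_one d, ← Real.rpow_add hd0']
      norm_num
    have h3 : √(√(d ^ 3)) ≤ √(√((2 * t) ^ 3)) :=
      Real.sqrt_le_sqrt (Real.sqrt_le_sqrt (pow_le_pow_left₀ hd0 hd 3))
    rw [h2]
    linarith

/-- The majorant of the matching: for `t ≥ 1`, `c > 0`,
`(2 + √(√((2t)³)))(1/t + 1/(ct)^{3/4+σ}) ≤ 4 (t^{-1/4} + c^{-(3/4+σ)} t^{-σ})`. [folklore] -/
theorem weight_mul_rate_le {c σ t : ℝ} (hc : 0 < c) (ht : 1 ≤ t) :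
    (2 + √(√((2 * t) ^ 3))) * (1 / t + 1 / (c * t) ^ (3 / 4 + σ : ℝ)) ≤
      4 * (t ^ (-(1 / 4) : ℝ) + c ^ (-(3 / 4 + σ) : ℝ) * t ^ (-σ : ℝ)) := by
  have ht0 : 0 < t := by linarith
  rw [sqrt_sqrt_cube t ht0.le, Real.mul_rpow zero_le_two ht0.le]
  -- `2 + 2^{3/4} t^{3/4} ≤ 4 t^{3/4}`
  have h34 : (1 : ℝ) ≤ t ^ (3 / 4 : ℝ) := Real.one_le_rpow ht (by norm_num)
  have h2 : (2 : ℝ) ^ (3 / 4 : ℝ) ≤ 2 := by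
    calc (2 : ℝ) ^ (3 / 4 : ℝ) ≤ 2 ^ (1 : ℝ) := Real.rpow_le_rpow_of_exponent_le one_le_two (by norm_num)
      _ = 2 := Real.rpow_one 2
  have hfac : 2 + (2 : ℝ) ^ (3 / 4 : ℝ) * t ^ (3 / 4 : ℝ) ≤ 4 * t ^ (3 / 4 : ℝ) := by nlinarith
  have hR : 0 ≤ 1 / t + 1 / (c * t) ^ (3 / 4 + σ : ℝ) := by positivity
  refine (mul_le_mul_of_nonneg_right hfac hR).trans (le_of_eq ?_)
  -- algebra of real powers
  have e1 : t ^ (3 / 4 : ℝ) * (1 / t) = t ^ (-(1 / 4) : ℝ) := by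
    rw [one_div, ← Real.rpow_neg_one, ← Real.rpow_add ht0]; norm_num
  have e2 : t ^ (3 / 4 : ℝ) * (1 / (c * t) ^ (3 / 4 + σ : ℝ)) = c ^ (-(3 / 4 + σ) : ℝ) * t ^ (-σ : ℝ) := by
    rw [Real.mul_rpow hc.le ht0.le, one_div, mul_inv, Real.rpow_neg hc.le, ← Real.rpow_neg ht0.le,
      show t ^ (3 / 4 : ℝ) * ((c ^ (3 / 4 + σ : ℝ))⁻¹ * t ^ (-(3 / 4 + σ) : ℝ)) =
        (c ^ (3 / 4 + σ : ℝ))⁻¹ * (t ^ (3 / 4 : ℝ) * t ^ (-(3 / 4 + σ) : ℝ)) by ring,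
      ← Real.rpow_add ht0]
    congr 2; ring
  calc 4 * t ^ (3 / 4 : ℝ) * (1 / t + 1 / (c * t) ^ (3 / 4 + σ : ℝ))
      = 4 * (t ^ (3 / 4 : ℝ) * (1 / t) + t ^ (3 / 4 : ℝ) * (1 / (c * t) ^ (3 / 4 + σ : ℝ))) := by ring
    _ = _ := by rw [e1, e2]

/-- **The weighted rate tends to zero**: `(2 + √(√((2t)³)))(1/t + 1/(ct)^{3/4+σ}) → 0` as `t → ∞`
for `c, σ > 0` (the monopole rate `σ` beats the weight). [folklore] -/
theorem tendsto_weight_mul_rate {c σ : ℝ} (hc : 0 < c) (hσ : 0 < σ) :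
    Tendsto (fun t : ℝ ↦ (2 + √(√((2 * t) ^ 3))) * (1 / t + 1 / (c * t) ^ (3 / 4 + σ : ℝ)))
      atTop (𝓝 0) := by
  have hlim : Tendsto (fun t : ℝ ↦ 4 * (t ^ (-(1 / 4) : ℝ) + c ^ (-(3 / 4 + σ) : ℝ) * t ^ (-σ : ℝ)))
      atTop (𝓝 0) := by
    have h1 := tendsto_rpow_neg_atTop (y := 1 / 4) (by norm_num)
    have h2 := (tendsto_rpow_neg_atTop hσ).const_mul (c ^ (-(3 / 4 + σ) : ℝ))
    simpa using (h1.add h2).const_mul 4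
  refine tendsto_of_tendsto_of_tendsto_of_le_of_le' tendsto_const_nhds hlim ?_ ?_
  · filter_upwards [eventually_ge_atTop 0] with t ht
    have : 0 ≤ 1 / t + 1 / (c * t) ^ (3 / 4 + σ : ℝ) := by positivity
    positivity
  · filter_upwards [eventually_ge_atTop 1] with t ht
    exact weight_mul_rate_le hc ht

/-- The unweighted rate tends to zero as well. [folklore] -/
theorem tendsto_rate {c σ : ℝ} (hc : 0 < c) (hσ : 0 < σ) :
    Tendsto (fun t : ℝ ↦ 1 / t + 1 / (c * t) ^ (3 / 4 + σ : ℝ)) atTop (𝓝 0) := by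
  refine tendsto_of_tendsto_of_tendsto_of_le_of_le' tendsto_const_nhds (tendsto_weight_mul_rate hc hσ) ?_ ?_
  · filter_upwards [eventually_ge_atTop 0] with t ht
    positivity
  · filter_upwards [eventually_ge_atTop 0] with t ht
    have h0 : 0 ≤ 1 / t + 1 / (c * t) ^ (3 / 4 + σ : ℝ) := by positivity
    have h1 : (1 : ℝ) ≤ 2 + √(√((2 * t) ^ 3)) := by linarith [Real.sqrt_nonneg (√((2 * t) ^ 3))]
    nlinarith

end OneHole

/-- Registered sub-goal form (stub `oneHole_weight_mul_scale_le` of the crux item) of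
`OneHole.weight_mul_scale_le`: the cone weight `1 + d^{7/4}` against the scale `(max 1 d)⁻¹` is at most
`2 + (2t)^{3/4}` for `d ≤ 2t`. [folklore] -/
theorem oneHole_weight_mul_scale_le : ∀ {d t : ℝ}, 0 ≤ d → d ≤ 2 * t → (1 + √(√(d ^ 7))) * (max 1 d)⁻¹ ≤ 2 + √(√((2 * t) ^ 3)) :=
  fun hd0 hd ↦ OneHole.weight_mul_scale_le hd0 hd

end Summit.FinalStateConjecture.FinalStateConjecture.Theorems

end
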